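import Literature.MathematicalPhysics.QuantumLattice.BdGBondHamiltonian
import Literature.MathematicalPhysics.QuantumLattice.DWaveSource
import Literature.MathematicalPhysics.QuantumLattice.HubbardFreePropagator
import Literature.MathematicalPhysics.QuantumLattice.PairCorrelationsProofs
import Literature.MathematicalPhysics.QuantumLattice.PairFieldMomentum
import HarnessLib

/-!
# The lattice BdG Hamiltonian on the fermionic torus `(ℤ/Lℤ)²` with nearest-neighbour bond data

Companion of `BdGBondHamiltonian.lean` (definition request `defn-bdgBondHamiltonian`, route
`HubbardSuperconductivity/NodalWardXY`, item `stmt-HubbardSuperconductivity-1266` `VisonPairCost`,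
and the vortex / flux-insertion cards): the specialisation in which hopping and singlet-pairing
amplitudes are given per DIRECTED nearest-neighbour bond `(x, x + eᵢ)` of the torus,
`τ Δ : TorusSite 2 L → Fin 2 → ℂ`, the orbitals being taken on the fermionic torus through
`FermionTorus.ofTorusSite` exactly as in the tree's `localPair` / `pairField` and in the route
statements.

## Contents (all statements PROVED; no named facts)

* `torusBondHop L x i σ = c†_{xσ} c_{x+eᵢ,σ}`, `torusBondPair L x i = c_{x↑}c_{x+eᵢ,↓} - c_{x↓}c_{x+eᵢ,↑}`
  (the directed-bond hopping monomial and singlet pair) and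
  `bdgTorus L τ Δ μ = Σ_{x,i} (Σ_σ (τ(x,i) c†_{xσ}c_{x+eᵢ,σ} + h.c.) + (Δ(x,i) b_{x,i} + h.c.)) - μN`.
* `isHermitian_bdgTorus` (every bond datum); `bdgTorus_eq_add_pairing` (the pairing field
  `Σ_{x,i} Δ(x,i) b_{x,i}` split off); **gauge covariance on the torus**
  `phaseGauge_mul_bdgTorus_mul_conjTranspose`: for `g : (ℤ/Lℤ)² → U(1)`,
  `W_g H(τ,Δ) W_gᴴ = H(g_x conj(g_{x+eᵢ}) τ, conj(g_x g_{x+eᵢ}) Δ)` (`W_g = phaseGauge` of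
  `MagneticHubbardTorus`, through `BdGBondHamiltonian`).
* Calibration against the tree (`L ≥ 3`, where the `2·2` directed bonds at a site are distinct):
  `hubbardTorusWith_zero_eq_bdgTorus` (`H(t, U=0) - μN = bdgTorus L (-t) 0 μ`),
  `pairField_dWaveFormFactor_eq` (`Δ_d = pairField dWaveFormFactor L = √2 (Σ_x b_{x,0} - Σ_x b_{x,1})`,
  valid for every `L ≥ 1`: the normalisation `1/√2` of `localPair` and the double counting of the
  undirected bonds `±eᵢ`), and `dWaveSourceTorus_zero_eq_bdgTorus`
  (`dWaveSourceTorus L 0 μ h = bdgTorus L (-1) (-(h√2) g) μ`): the uniform `d`-wave BdG state of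
  the route is the `U = 0` Koma–Tasaki-sourced Hubbard Hamiltonian.

## Sources

P. G. de Gennes, *Superconductivity of Metals and Alloys* (1966), Ch. 5 [deGennes1966];
O. Vafek, A. Melikyan, M. Franz, Z. Tešanović, PRB 63 (2001) 134509, §II eqs. (2)–(4) and App. A
(A1)–(A2) (tight-binding lattice `d`-wave BdG Hamiltonian with bond phases; vortices as bond data)
[VafekEtAl2001]; D. J. Scalapino, Phys. Rep. 250 (1995) 329, §2 eqs. (2.2)–(2.3) (the
`d_{x²-y²}` pair field) [Scalapino1995]; T. Koma, H. Tasaki, PRL 68 (1992) 3248, eq. (8)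
[KomaTasakiPRL1992].

## Design notes / not here

* `d = 2` only (as `localPair`). The general-`Λ` object is `bdgBondHamiltonian`; the bridge
  `bdgTorus L τ Δ μ = bdgBondHamiltonian τ' Δ' μ` (with `τ', Δ'` the bond data spread on ordered
  site pairs) is not needed by the present consumers and is not stated.
* The `L ≥ 3` hypotheses are genuine: for `L ≤ 2` the directed bonds `x ± eᵢ` coincide and the
  bond sums double-count relative to the graph-based `hubbardTorus`.
-/

noncomputable section

namespace Literature.MathematicalPhysics.QuantumLattice

open Matrix Finset Literature.Probability.LatticeModels
open scoped ComplexOrder ComplexConjugate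

/-! ### Two pieces of bookkeeping -/

section Bookkeeping

variable {Λ : Type*} [LinearOrder Λ] [Fintype Λ]

/-- The singlet bond pair is symmetric in its two sites as an operator:
`c_{v↑}c_{u↓} - c_{v↓}c_{u↑} = c_{u↑}c_{v↓} - c_{u↓}c_{v↑}` (anticommutation of annihilation
operators). [folklore] -/
theorem annihilation_singlet_swap (u v : Λ) :
    annihilation (orb v 0) * annihilation (orb u 1) - annihilation (orb v 1) * annihilation (orb u 0) =
      (annihilation (orb u 0) * annihilation (orb v 1) -
        annihilation (orb u 1) * annihilation (orb v 0) :
          Matrix (Finset (Orb Λ)) (Finset (Orb Λ)) ℂ) := by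
  have h : ∀ a b : Orb Λ, annihilation a * annihilation b =
      -(annihilation b * annihilation a : Matrix (Finset (Orb Λ)) (Finset (Orb Λ)) ℂ) :=
    fun a b => eq_neg_of_add_eq_zero_left (annihilation_anticommute_holds a b)
  rw [h (orb v 0) (orb u 1), h (orb v 1) (orb u 0)]
  abel

end Bookkeeping

section TorusBookkeeping

variable {d L : ℕ}

/-- `Torus.proj` of a unit step is the unit step of the torus. [folklore] -/
theorem torusProj_unitStep (L : ℕ) (i : Fin d) :
    Torus.proj (d := d) L (Pi.single i 1) = Pi.single i 1 := by
  funext j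
  by_cases h : j = i
  · subst h; simp [Torus.proj]
  · simp [Torus.proj, h]

/-- `Torus.proj` of a backward unit step. [folklore] -/
theorem torusProj_neg_unitStep (L : ℕ) (i : Fin d) :
    Torus.proj (d := d) L (-Pi.single i 1) = -Pi.single i 1 := by
  rw [Torus.proj_neg, torusProj_unitStep]

/-- `0` is not one of the four unit steps of `ℤ²`. [folklore] -/
theorem zero_not_mem_unitSteps : (0 : Site 2) ∉ unitSteps := by
  simp only [unitSteps, Finset.mem_insert, Finset.mem_singleton]
  decide

/-- A sum over the four unit steps `{e₁, -e₁, e₂, -e₂}` of `ℤ²`, expanded. [folklore] -/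
theorem sum_unitSteps {M : Type*} [AddCommMonoid M] (f : Site 2 → M) :
    ∑ e ∈ unitSteps, f e =
      f (Pi.single 0 1) + (f (-Pi.single 0 1) + (f (Pi.single 1 1) + f (-Pi.single 1 1))) := by
  have h1 : (Pi.single 0 1 : Site 2) ∉
      ({-Pi.single 0 1, Pi.single 1 1, -Pi.single 1 1} : Finset (Site 2)) := by
    simp only [Finset.mem_insert, Finset.mem_singleton]; decide
  have h2 : (-Pi.single 0 1 : Site 2) ∉ ({Pi.single 1 1, -Pi.single 1 1} : Finset (Site 2)) := by
    simp only [Finset.mem_insert, Finset.mem_singleton]; decide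
  have h3 : (Pi.single 1 1 : Site 2) ∉ ({-Pi.single 1 1} : Finset (Site 2)) := by
    simp only [Finset.mem_singleton]; decide
  rw [unitSteps, Finset.sum_insert h1, Finset.sum_insert h2, Finset.sum_insert h3,
    Finset.sum_singleton]

/-- The `d_{x²-y²}` form factor on the unit steps: `g(±e₁) = 1`, `g(±e₂) = -1`.
Scalapino, Phys. Rep. 250 (1995) 329, §2 eq. (2.3). [folklore] -/
theorem dWaveFormFactor_unitStep (i : Fin 2) :
    dWaveFormFactor (Pi.single i 1) = if i = 0 then 1 else -1 := by
  fin_cases i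
  · exact if_pos (Or.inl rfl)
  · simp only [Fin.mk_one, Fin.isValue, one_ne_zero, if_false]
    unfold dWaveFormFactor
    rw [if_neg (by decide), if_pos (Or.inl rfl)]

/-- The `d_{x²-y²}` form factor on the backward unit steps. Scalapino (1995) §2 eq. (2.3). [folklore] -/
theorem dWaveFormFactor_neg_unitStep (i : Fin 2) :
    dWaveFormFactor (-Pi.single i 1) = if i = 0 then 1 else -1 := by
  rw [dWaveFormFactor_neg, dWaveFormFactor_unitStep]

/-- Shifting a diagonal-type sum on the torus: `Σ_x F(x, x - e) = Σ_x F(x + e, x)` (reindex by the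
translation `x ↦ x + e`). [folklore] -/
theorem TorusSite.sum_sub_shift [NeZero L] {M : Type*} [AddCommMonoid M] (e : TorusSite d L)
    (F : TorusSite d L → TorusSite d L → M) : ∑ x, F x (x - e) = ∑ x, F (x + e) x :=
  Fintype.sum_equiv (Equiv.subRight e) _ _ fun x => by
    simp only [Equiv.subRight_apply, sub_add_cancel]

/-- Matrix-valued neighbour sums on the torus, `L ≥ 3`: `Σ_{y ∼ x} g(y) = Σᵢ (g(x+eᵢ) + g(x-eᵢ))`
(the tree's `sum_ite_torusGraph_adj`, entrywise). Friedli–Velenik (2017) §3.1. [folklore] -/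
theorem sum_ite_torusGraph_adj_matrix [NeZero L] {n : Type*} (hL : 3 ≤ L) (x : TorusSite d L)
    (g : TorusSite d L → Matrix n n ℂ) :
    (∑ y, if (torusGraph d L).Adj x y then g y else 0) =
      ∑ i, (g (x + Pi.single i 1) + g (x - Pi.single i 1)) := by
  ext a b
  calc (∑ y, if (torusGraph d L).Adj x y then g y else 0) a b
      = ∑ y, if (torusGraph d L).Adj x y then g y a b else 0 := by
        rw [Matrix.sum_apply]
        exact Finset.sum_congr rfl fun y _ => by split_ifs <;> rfl
    _ = ∑ i, (g (x + Pi.single i 1) a b + g (x - Pi.single i 1) a b) :=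
        sum_ite_torusGraph_adj hL x _
    _ = (∑ i, (g (x + Pi.single i 1) + g (x - Pi.single i 1))) a b := by
        rw [Matrix.sum_apply]
        rfl

end TorusBookkeeping

/-! ### The BdG Hamiltonian on the torus -/

section Torus

variable (L : ℕ) [NeZero L]

/-- The hopping monomial of the directed bond `(x, x + eᵢ)` of the torus `(ℤ/Lℤ)²` with spin `σ`,
`c†_{xσ} c_{x+eᵢ,σ}` (orbitals on the fermionic torus via `FermionTorus.ofTorusSite`).
Vafek et al. (2001) §II eq. (3) (`ŝ_δ`). [folklore] -/
def torusBondHop (x : TorusSite 2 L) (i : Fin 2) (σ : Fin 2) :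
    Matrix (Finset (Orb (FermionTorus 2 L))) (Finset (Orb (FermionTorus 2 L))) ℂ :=
  creation (orb (FermionTorus.ofTorusSite x) σ) *
    annihilation (orb (FermionTorus.ofTorusSite (x + Pi.single i 1)) σ)

/-- The singlet pair annihilation operator of the directed bond `(x, x + eᵢ)`,
`b_{x,i} = c_{x↑} c_{x+eᵢ,↓} - c_{x↓} c_{x+eᵢ,↑}` — the summand of the tree's
`localPair g L x` at the step `e = eᵢ`, without its weight `g(eᵢ)/√2`.
Scalapino, Phys. Rep. 250 (1995) 329, §2 eqs. (2.2)–(2.3). [folklore] -/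
def torusBondPair (x : TorusSite 2 L) (i : Fin 2) :
    Matrix (Finset (Orb (FermionTorus 2 L))) (Finset (Orb (FermionTorus 2 L))) ℂ :=
  annihilation (orb (FermionTorus.ofTorusSite x) 0) *
      annihilation (orb (FermionTorus.ofTorusSite (x + Pi.single i 1)) 1) -
    annihilation (orb (FermionTorus.ofTorusSite x) 1) *
      annihilation (orb (FermionTorus.ofTorusSite (x + Pi.single i 1)) 0)

/-- **The lattice BdG Hamiltonian on the torus `(ℤ/Lℤ)²` with nearest-neighbour bond data**: for
hopping amplitudes `τ(x,i)` and singlet pairing amplitudes `Δ(x,i)` on the directed bonds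
`(x, x + eᵢ)` and a chemical potential `μ`,
`bdgTorus L τ Δ μ = Σ_{x,i} ( Σ_σ (τ(x,i) c†_{xσ} c_{x+eᵢ,σ} + h.c.) + (Δ(x,i) b_{x,i} + h.c.) ) - μ N`.
Uniform data `τ = -t`, `Δ(x,i) = Δ₀ gᵢ` is the `d`-wave BdG reference state
(`dWaveSourceTorus_zero_eq_bdgTorus`); Peierls phases, `ℤ₂` flux strings (visons), vortices and
boundary twists are non-uniform bond data. Vafek et al., PRB 63 (2001) 134509, §II eqs. (2)–(4),
App. A (A1); de Gennes (1966) §5-1 eq. (5-12). [cite: VafekEtAl2001, §II eqs. (2)–(4) and App. A eq. (A1)] -/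
def bdgTorus (τ Δ : TorusSite 2 L → Fin 2 → ℂ) (μ : ℝ) :
    Matrix (Finset (Orb (FermionTorus 2 L))) (Finset (Orb (FermionTorus 2 L))) ℂ :=
  ∑ x : TorusSite 2 L, ∑ i : Fin 2,
    ((∑ σ : Fin 2, (τ x i • torusBondHop L x i σ + (τ x i • torusBondHop L x i σ)ᴴ)) +
      (Δ x i • torusBondPair L x i + (Δ x i • torusBondPair L x i)ᴴ)) -
    (μ : ℂ) • totalNumber

variable {L}

/-- `torusBondHop` unfolded. [folklore] -/
theorem torusBondHop_eq (x : TorusSite 2 L) (i : Fin 2) (σ : Fin 2) :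
    torusBondHop L x i σ = creation (orb (FermionTorus.ofTorusSite x) σ) *
      annihilation (orb (FermionTorus.ofTorusSite (x + Pi.single i 1)) σ) := rfl

/-- `torusBondPair` unfolded. [folklore] -/
theorem torusBondPair_eq (x : TorusSite 2 L) (i : Fin 2) :
    torusBondPair L x i =
      annihilation (orb (FermionTorus.ofTorusSite x) 0) *
          annihilation (orb (FermionTorus.ofTorusSite (x + Pi.single i 1)) 1) -
        annihilation (orb (FermionTorus.ofTorusSite x) 1) *
          annihilation (orb (FermionTorus.ofTorusSite (x + Pi.single i 1)) 0) := rfl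

/-- The adjoint of the hopping monomial is the reversed hopping, `(c†_{xσ}c_{x+eᵢ,σ})ᴴ =
c†_{x+eᵢ,σ} c_{xσ}`. [folklore] -/
theorem torusBondHop_conjTranspose (x : TorusSite 2 L) (i : Fin 2) (σ : Fin 2) :
    (torusBondHop L x i σ)ᴴ = creation (orb (FermionTorus.ofTorusSite (x + Pi.single i 1)) σ) *
      annihilation (orb (FermionTorus.ofTorusSite x) σ) := by
  rw [torusBondHop, conjTranspose_mul, creation_conjTranspose, annihilation_conjTranspose]

variable (L)

/-- `bdgTorus` unfolded. [folklore] -/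
theorem bdgTorus_eq (τ Δ : TorusSite 2 L → Fin 2 → ℂ) (μ : ℝ) :
    bdgTorus L τ Δ μ = ∑ x : TorusSite 2 L, ∑ i : Fin 2,
      ((∑ σ : Fin 2, (τ x i • torusBondHop L x i σ + (τ x i • torusBondHop L x i σ)ᴴ)) +
        (Δ x i • torusBondPair L x i + (Δ x i • torusBondPair L x i)ᴴ)) -
      (μ : ℂ) • totalNumber := rfl

/-- **The torus BdG Hamiltonian is Hermitian** for all bond data (each bond contributes `A + Aᴴ`).
de Gennes (1966) §5-1. [folklore] -/
theorem isHermitian_bdgTorus (τ Δ : TorusSite 2 L → Fin 2 → ℂ) (μ : ℝ) :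
    (bdgTorus L τ Δ μ).IsHermitian := by
  have hN : ((μ : ℂ) • (totalNumber :
      Matrix (Finset (Orb (FermionTorus 2 L))) (Finset (Orb (FermionTorus 2 L))) ℂ)).IsHermitian :=
    totalNumber_isHermitian.smul (by rw [isSelfAdjoint_iff, Complex.star_def, Complex.conj_ofReal])
  refine IsHermitian.sub (IsSelfAdjoint.isHermitian ?_) hN
  refine isSelfAdjoint_sum _ fun x _ => isSelfAdjoint_sum _ fun i _ => ?_
  refine IsSelfAdjoint.add (isSelfAdjoint_sum _ fun σ _ => ?_) ?_
  · exact (isHermitian_add_transpose_self _).isSelfAdjoint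
  · exact (isHermitian_add_transpose_self _).isSelfAdjoint

/-- Real bond data: `bdgTorus L τ Δ μ = Σ_{x,i} (τ(x,i) Σ_σ (c†_{xσ}c_{x+eᵢ,σ} + h.c.) +
Δ(x,i) (b_{x,i} + b_{x,i}†)) - μN` — the shape in which route `NodalWardXY` inlines its `ℤ₂`-flux
BdG Hamiltonians (`τ = -s`, `Δ = s Δ₀ gᵢ` with signs `s(x,i) = ±1`). [folklore] -/
theorem bdgTorus_ofReal (τ Δ : TorusSite 2 L → Fin 2 → ℝ) (μ : ℝ) :
    bdgTorus L (fun x i => (τ x i : ℂ)) (fun x i => (Δ x i : ℂ)) μ =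
      ∑ x : TorusSite 2 L, ∑ i : Fin 2,
        ((τ x i : ℂ) • (∑ σ : Fin 2, (torusBondHop L x i σ + (torusBondHop L x i σ)ᴴ)) +
          (Δ x i : ℂ) • (torusBondPair L x i + (torusBondPair L x i)ᴴ)) -
        (μ : ℂ) • totalNumber := by
  simp only [bdgTorus, conjTranspose_smul, Complex.star_def, Complex.conj_ofReal, smul_add,
    Finset.smul_sum]

/-- Splitting off the pairing field: `bdgTorus L τ Δ μ = bdgTorus L τ 0 μ + (P + Pᴴ)` with
`P = Σ_{x,i} Δ(x,i) b_{x,i}`. [folklore] -/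
theorem bdgTorus_eq_add_pairing (τ Δ : TorusSite 2 L → Fin 2 → ℂ) (μ : ℝ) :
    bdgTorus L τ Δ μ = bdgTorus L τ 0 μ +
      ((∑ x : TorusSite 2 L, ∑ i : Fin 2, Δ x i • torusBondPair L x i) +
        (∑ x : TorusSite 2 L, ∑ i : Fin 2, Δ x i • torusBondPair L x i)ᴴ) := by
  simp only [bdgTorus, Pi.zero_apply, zero_smul, conjTranspose_zero, add_zero, conjTranspose_sum,
    Finset.sum_add_distrib]
  abel

/-! ### Gauge covariance on the torus -/

/-- Gauge transform of a directed-bond hopping monomial: `W_g c†_{xσ}c_{x+eᵢ,σ} W_gᴴ =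
g_x conj(g_{x+eᵢ}) c†_{xσ}c_{x+eᵢ,σ}`. [cite: KomaTasakiPRL1992, eq. (7)] -/
theorem phaseGauge_mul_torusBondHop_mul_conjTranspose (g : FermionTorus 2 L → Circle)
    (x : TorusSite 2 L) (i : Fin 2) (σ : Fin 2) :
    phaseGauge g * torusBondHop L x i σ * (phaseGauge g)ᴴ =
      ((g (FermionTorus.ofTorusSite x) : ℂ) *
        conj (g (FermionTorus.ofTorusSite (x + Pi.single i 1)) : ℂ)) • torusBondHop L x i σ := by
  rw [torusBondHop, phaseGauge_mul_mul_mul_conjTranspose, phaseGauge_mul_creation_mul_conjTranspose,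
    phaseGauge_mul_annihilation_mul_conjTranspose, smul_mul_smul]

/-- Gauge transform of a directed-bond singlet pair: `W_g b_{x,i} W_gᴴ =
conj(g_x g_{x+eᵢ}) b_{x,i}`. [cite: KomaTasakiPRL1992, eq. (8)] -/
theorem phaseGauge_mul_torusBondPair_mul_conjTranspose (g : FermionTorus 2 L → Circle)
    (x : TorusSite 2 L) (i : Fin 2) :
    phaseGauge g * torusBondPair L x i * (phaseGauge g)ᴴ =
      (conj (g (FermionTorus.ofTorusSite x) : ℂ) *
        conj (g (FermionTorus.ofTorusSite (x + Pi.single i 1)) : ℂ)) • torusBondPair L x i := by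
  rw [torusBondPair, Matrix.mul_sub, Matrix.sub_mul, phaseGauge_mul_mul_mul_conjTranspose,
    phaseGauge_mul_mul_mul_conjTranspose, phaseGauge_mul_annihilation_mul_conjTranspose,
    phaseGauge_mul_annihilation_mul_conjTranspose, phaseGauge_mul_annihilation_mul_conjTranspose,
    phaseGauge_mul_annihilation_mul_conjTranspose, smul_mul_smul, smul_mul_smul, ← smul_sub]

/-- **`U(1)` gauge covariance of the torus BdG Hamiltonian**: conjugation by the unitary
site-phase transformation `W_g` of a `U(1)`-valued site function `g` on `(ℤ/Lℤ)²` multiplies the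
hopping amplitude of the bond `(x, x+eᵢ)` by the Peierls factor `g_x conj(g_{x+eᵢ})`
(`= e^{i(θ_x - θ_{x+eᵢ})}` for `g = e^{iθ}`) and its pairing amplitude by `conj(g_x g_{x+eᵢ})`
(`= e^{-i(θ_x + θ_{x+eᵢ})}`). de Gennes (1966) §5-2; Vafek et al. (2001) App. A (A2).
[cite: VafekEtAl2001, App. A eq. (A2)] -/
theorem phaseGauge_mul_bdgTorus_mul_conjTranspose (g : TorusSite 2 L → Circle)
    (τ Δ : TorusSite 2 L → Fin 2 → ℂ) (μ : ℝ) :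
    phaseGauge (fun u : FermionTorus 2 L => g u.toTorusSite) * bdgTorus L τ Δ μ *
        (phaseGauge fun u : FermionTorus 2 L => g u.toTorusSite)ᴴ =
      bdgTorus L (fun x i => (g x : ℂ) * conj (g (x + Pi.single i 1) : ℂ) * τ x i)
        (fun x i => conj (g x : ℂ) * conj (g (x + Pi.single i 1) : ℂ) * Δ x i) μ := by
  unfold bdgTorus
  rw [Matrix.mul_sub, Matrix.sub_mul, Matrix.mul_smul, Matrix.smul_mul,
    phaseGauge_mul_totalNumber_mul_conjTranspose, Finset.mul_sum, Finset.sum_mul]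
  congr 1
  refine Finset.sum_congr rfl fun x _ => ?_
  rw [Finset.mul_sum, Finset.sum_mul]
  refine Finset.sum_congr rfl fun i _ => ?_
  rw [Matrix.mul_add, Matrix.add_mul, Matrix.mul_add, Matrix.add_mul, Finset.mul_sum,
    Finset.sum_mul]
  congr 1
  · refine Finset.sum_congr rfl fun σ _ => ?_
    rw [Matrix.mul_add, Matrix.add_mul, phaseGauge_mul_conjTranspose_mul_conjTranspose,
      Matrix.mul_smul, Matrix.smul_mul, phaseGauge_mul_torusBondHop_mul_conjTranspose, smul_smul]
    simp only [FermionTorus.toTorusSite_ofTorusSite, mul_comm (τ x i)]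
  · rw [phaseGauge_mul_conjTranspose_mul_conjTranspose, Matrix.mul_smul, Matrix.smul_mul,
      phaseGauge_mul_torusBondPair_mul_conjTranspose, smul_smul]
    simp only [FermionTorus.toTorusSite_ofTorusSite, mul_comm (Δ x i)]

/-! ### Calibration against the Hubbard model and the `d`-wave source (`L ≥ 3`) -/

/-- **The hopping term of the torus Hubbard model in directed-bond form** (`L ≥ 3`):
`Σ_{X ∼ Y} Σ_σ c†_{Xσ} c_{Yσ} = Σ_{x,i,σ} (c†_{xσ}c_{x+eᵢ,σ} + h.c.)` — the neighbours of `x` are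
the four distinct sites `x ± eᵢ`, and the backward bonds are the forward bonds read from their
far end (reindex `x ↦ x + eᵢ`). Friedli–Velenik (2017) §3.1; Lieb–Wu, PRL 20 (1968) 1445. [folklore] -/
theorem hubbard_hopping_torus_eq_sum_torusBondHop (hL : 3 ≤ L) :
    (∑ X : FermionTorus 2 L, ∑ Y : FermionTorus 2 L, ∑ σ : Fin 2,
        if (fermionTorusGraph 2 L).Adj X Y then creation (orb X σ) * annihilation (orb Y σ) else 0) =
      ∑ x : TorusSite 2 L, ∑ i : Fin 2, ∑ σ : Fin 2,
        (torusBondHop L x i σ + (torusBondHop L x i σ)ᴴ) := by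
  -- Step 1: sums over the fermionic torus as sums over `(ℤ/Lℤ)²`, spin sum inside the indicator
  have s1 : (∑ X : FermionTorus 2 L, ∑ Y : FermionTorus 2 L, ∑ σ : Fin 2,
        if (fermionTorusGraph 2 L).Adj X Y then creation (orb X σ) * annihilation (orb Y σ) else 0) =
      ∑ x : TorusSite 2 L, ∑ y : TorusSite 2 L, if (torusGraph 2 L).Adj x y then
        ∑ σ : Fin 2, creation (orb (FermionTorus.ofTorusSite x) σ) *
          annihilation (orb (FermionTorus.ofTorusSite y) σ) else 0 := by
    rw [FermionTorus.sum_eq_sum_torusSite]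
    refine Finset.sum_congr rfl fun x _ => ?_
    rw [FermionTorus.sum_eq_sum_torusSite]
    refine Finset.sum_congr rfl fun y _ => ?_
    simp only [fermionTorusGraph_adj, FermionTorus.toTorusSite_ofTorusSite]
    split_ifs <;> simp
  -- Step 2: the backward bonds, read from their far end (reindex `x ↦ x + eᵢ`)
  have hshift : ∀ (i : Fin 2) (σ : Fin 2),
      (∑ x : TorusSite 2 L, creation (orb (FermionTorus.ofTorusSite x) σ) *
          annihilation (orb (FermionTorus.ofTorusSite (x - Pi.single i 1)) σ)) =
      ∑ x : TorusSite 2 L, creation (orb (FermionTorus.ofTorusSite (x + Pi.single i 1)) σ) *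
          annihilation (orb (FermionTorus.ofTorusSite x) σ) := fun i σ =>
    TorusSite.sum_sub_shift (Pi.single i 1) fun x y =>
      creation (orb (FermionTorus.ofTorusSite x) σ) * annihilation (orb (FermionTorus.ofTorusSite y) σ)
  -- Step 3: neighbour sums in directed-bond form (`L ≥ 3`), expand and compare
  rw [s1]
  simp only [sum_ite_torusGraph_adj_matrix hL, Fin.sum_univ_two, Fin.isValue, Finset.sum_add_distrib,
    hshift, torusBondHop, conjTranspose_mul, creation_conjTranspose, annihilation_conjTranspose]

/-- **The free grand-canonical Hubbard model on the torus is a BdG Hamiltonian with uniform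
hopping data and no pairing** (`L ≥ 3`): `hubbardTorusWith 2 L t 0 μ = bdgTorus L (-t) 0 μ`.
[folklore] -/
theorem hubbardTorusWith_zero_eq_bdgTorus (hL : 3 ≤ L) (t μ : ℝ) :
    hubbardTorusWith 2 L t 0 μ = bdgTorus L (fun _ _ => -(t : ℂ)) 0 μ := by
  rw [hubbardTorusWith, hamiltonianWith, hamiltonian, hubbard_hopping_torus_eq_sum_torusBondHop L hL,
    bdgTorus]
  simp only [Complex.ofReal_zero, zero_smul, add_zero, Pi.zero_apply, conjTranspose_zero,
    Finset.smul_sum, smul_add, conjTranspose_smul, star_neg, Complex.star_def, Complex.conj_ofReal,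
    Finset.sum_const_zero]

/-- **The `d_{x²-y²}` pair field in directed-bond form** (every `L ≥ 1`):
`pairField dWaveFormFactor L = √2 (Σ_x b_{x,1st axis} - Σ_x b_{x,2nd axis})`. The factor
`√2 = 2/√2` collects the weight `g(e)/√2` of `localPair` and the two orientations `±eᵢ` of each
bond, the backward bonds being forward bonds read from their far end (`annihilation_singlet_swap`).
Scalapino, Phys. Rep. 250 (1995) 329, §2 eqs. (2.2)–(2.3). [folklore] -/
theorem pairField_dWaveFormFactor_eq :
    pairField dWaveFormFactor L =
      ((Real.sqrt 2 : ℝ) : ℂ) •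
        (∑ x : TorusSite 2 L, torusBondPair L x 0 - ∑ x : TorusSite 2 L, torusBondPair L x 1) := by
  -- backward bonds are forward bonds read from their far end
  have hback : ∀ (a : ℂ) (i : Fin 2),
      (∑ x : TorusSite 2 L, a •
        (annihilation (orb (FermionTorus.ofTorusSite x) 0) *
            annihilation (orb (FermionTorus.ofTorusSite (x + -Pi.single i 1)) 1) -
          annihilation (orb (FermionTorus.ofTorusSite x) 1) *
            annihilation (orb (FermionTorus.ofTorusSite (x + -Pi.single i 1)) 0))) =
      ∑ x : TorusSite 2 L, a • torusBondPair L x i := by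
    intro a i
    refine Fintype.sum_equiv (Equiv.addRight (-Pi.single i 1 : TorusSite 2 L)) _ _ fun x => ?_
    rw [annihilation_singlet_swap, torusBondPair_eq, Equiv.coe_addRight, neg_add_cancel_right]
  -- the numerical factors `1/√2 + 1/√2 = √2`
  have hr : 1 / Real.sqrt 2 + 1 / Real.sqrt 2 = Real.sqrt 2 := by
    rw [← two_mul, mul_one_div, div_eq_iff (Real.sqrt_ne_zero'.2 two_pos),
      Real.mul_self_sqrt two_pos.le]
  have hs : ((1 / Real.sqrt 2 : ℝ) : ℂ) + ((1 / Real.sqrt 2 : ℝ) : ℂ) = ((Real.sqrt 2 : ℝ) : ℂ) := by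
    rw [← Complex.ofReal_add, hr]
  have hs' : ((-1 / Real.sqrt 2 : ℝ) : ℂ) + ((-1 / Real.sqrt 2 : ℝ) : ℂ) =
      -((Real.sqrt 2 : ℝ) : ℂ) := by
    rw [← Complex.ofReal_add, ← Complex.ofReal_neg, neg_div, ← neg_add, hr]
  unfold pairField localPair
  simp only [Finset.sum_insert zero_not_mem_unitSteps, dWaveFormFactor_zero, zero_div,
    Complex.ofReal_zero, zero_smul, zero_add, sum_unitSteps, dWaveFormFactor_neg_unitStep,
    dWaveFormFactor_unitStep, torusProj_unitStep, torusProj_neg_unitStep, Fin.isValue,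
    if_true, one_ne_zero, if_false, Finset.sum_add_distrib, hback, ← torusBondPair_eq]
  simp only [← Finset.smul_sum]
  rw [← add_assoc, ← add_smul, ← add_smul, hs, hs', neg_smul, smul_sub, sub_eq_add_neg]

/-- **The uniform `d`-wave BdG state is the `U = 0` Koma–Tasaki-sourced Hubbard Hamiltonian**
(`L ≥ 3`): `dWaveSourceTorus L 0 μ h = H(1, 0) - μN - h(Δ_d + Δ_d†)` is `bdgTorus` with uniform
hopping `-1` and bond pairing `Δ(x,i) = -h√2 · gᵢ`, `g = (1, -1)` (the factor `√2` is the
normalisation of `pairField`, `pairField_dWaveFormFactor_eq`). This is the `d_{x²-y²}` BdG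
reference state of route `NodalWardXY` at `Δ₀ = -h√2` (the sign is a `ℤ₂` gauge choice).
Koma–Tasaki (1994) §1 (sourced Hamiltonian); Vafek et al. (2001) §II. [folklore] -/
theorem dWaveSourceTorus_zero_eq_bdgTorus (hL : 3 ≤ L) (μ h : ℝ) :
    dWaveSourceTorus L 0 μ h =
      bdgTorus L (fun _ _ => -1)
        (fun _ i => -((h * Real.sqrt 2 * (if i = 0 then 1 else -1) : ℝ) : ℂ)) μ := by
  -- the pairing field of the uniform `d`-wave bond data
  have hΔ : (∑ x : TorusSite 2 L, ∑ i : Fin 2,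
      (-((h * Real.sqrt 2 * (if i = 0 then 1 else -1) : ℝ) : ℂ)) • torusBondPair L x i) =
      -((h : ℂ) • (((Real.sqrt 2 : ℝ) : ℂ) •
        (∑ x : TorusSite 2 L, torusBondPair L x 0 - ∑ x : TorusSite 2 L, torusBondPair L x 1))) := by
    simp only [Fin.sum_univ_two, Fin.isValue, if_true, one_ne_zero, if_false, Complex.ofReal_mul,
      Complex.ofReal_one, Complex.ofReal_neg, mul_one, mul_neg_one, Finset.sum_add_distrib,
      smul_sub, Finset.smul_sum, smul_smul, neg_smul, Finset.sum_neg_distrib]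
    abel
  rw [dWaveSourceTorus, hubbardTorusWith_zero_eq_bdgTorus L hL, pairField_dWaveFormFactor_eq L,
    bdgTorus_eq_add_pairing L (fun _ _ => -1), hΔ, Complex.ofReal_one]
  simp only [conjTranspose_neg, conjTranspose_smul, Complex.star_def, Complex.conj_ofReal, smul_add]
  abel

end Torus

end Literature.MathematicalPhysics.QuantumLattice
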